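import Literature.Analysis.FluidPDE.GKPCriticalElementsPathSpace
import HarnessLib

/-!
# GKP Theorem 1 over Gallagher–Koch–Planchon's own solution class

Proof-only sibling of `Literature/Analysis/FluidPDE/CriticalRegularity.lean` (named fact
`Literature.Analysis.FluidPDE.gkp_besov_blowup` = Gallagher–Koch–Planchon 2016, Thm. 1: blow-up of
the critical Besov norms `Ḃ^{-1+3/p}_{p,q}`, `3 < p, q < ∞`, at the maximal time of `NS(u₀)`) and of
`GKPCriticalElementsPathSpace.lean` / `GKPRegularityPersistence.lean` (GKP's path-space class
`MemGKPPathSpace p q T U` = "`U ∈ 𝓛^{1:∞}_{p,q}[T' < T]`", and the audit of the standing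
identification of `CriticalRegularity.lean`). No definition, no named fact; nothing accepted is
restated or changed.

## What is printed and what is vendored

In print (arXiv:1407.4156, p. 4–5), Theorem 1 concerns `NS(u₀)`, the unique solution of the
Duhamel equation (1.2) in `X_T = 𝓛^{1:∞}_{p,q}(T)`, and its maximal time
`T*(u₀) = T*_{𝓛^{1:∞}_{p,q}(T)}(u₀)` ((1.3)): *if `T*(u₀) < ∞` then
`limsup_{t → T*(u₀)} ‖NS(u₀)(t)‖_{Ḃ^{s_p}_{p,q}} = ∞`*. The vendored `gkp_besov_blowup` quantifies
instead over the tree's class: `IsMaximalBesovMildSolution` = a duality-form mild solution in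
Kato's class `K_∞`, continuous in `Ḃ^{s_p}_{p,q}` through the distributions of its slices, with
**no extension in that class**. The two maximality notions ("no extension in `𝓛^{1:∞}[T' < T]`"
versus "no extension in the tree's class") agree under the identification `hId` — every member of
the tree's class lies in GKP's path space — which is the design assumption of
`CriticalRegularity.lean` ("Kato's class … in which mild solutions are unique") and is *not* a
published theorem (audit in `GKPRegularityPersistence.lean`: Fujii 2026, Thm. 1.2; Miura 2005,
Thm. 2.3). Without `hId` the printed and the vendored statements are incomparable.

## What this file proves

* `gkp_besov_blowup_of_pathSpaceBlowup : hP → hId → gkp_besov_blowup` — the vendored fact is **Theorem 1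
  over GKP's class** (hypothesis `hP`: a Besov mild solution on `[0, T)` lying in
  `𝓛^{1:∞}_{p,q}[T' < T]` with no extension in that class has `limsup_{t → T⁻} ‖U t‖ = ∞`; this is
  the printed theorem under the rendering of `NS(u₀)|_{[0,T)}`, `T ≤ T*`, by "Besov mild solution in
  the path space", in which (1.2) has a unique solution, GKP (1.6)/(1.7) of the arXiv version)
  **plus** the identification `hId`;
* `pathSpaceBlowup_of_gkp_besov_blowup : gkp_besov_blowup → hId → hP` — conversely, under `hId` the
  vendored fact gives back the path-space form, so that `gkp_besov_blowup_iff_pathSpaceBlowup : hId →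
  (gkp_besov_blowup ↔ hP)`;
* `exists_extension_pathSpace_of_biSup_lt_top` — the continuation (`sup`) form of `hP`, the shape
  consumed by continuation criteria (`NSCriticalClosureBesov*.lean`): a Besov mild solution in GKP's
  class whose critical norm stays bounded on `[0, T)` extends, within GKP's class, past `T`
  (`limsup ≤ sup`, `limsup_nhdsLT_le_biSup_Ico`).

`hP` is written out verbatim (as hypothesis, like `hP` of `gkp_exists_criticalElement_of_pathSpace`)
and is not vendored as a named fact here (D-0026: this file adds no debt). Compare the capstone
`gkp_besov_blowup_of_pathSpace` of `GKPRigidityProofs.lean`, which derives `gkp_besov_blowup` from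
the *four* statements of GKP §2.1 over the path-space class ((1.9)+(1.6), Props. 2.1–2.3) and
`hId`; here the single hypothesis is Theorem 1 itself over that class — the form reached by every
published proof line (GKP §2; Albritton 2018, Thm. 1.1) — and the converse under `hId` is recorded
as well. Its proof is GKP §2
(or Albritton 2018, Thm. 1.1, whose uniqueness class, Thm. 4.2 there, is again a Kato-type path
space) and rests on theory absent from Mathlib and from this tree; see `CriticalRegularityProofs.lean`,
`GKPCriticalElementsProofs.lean`, `AlbrittonBlowupCriterion.lean` for the in-tree reductions of the
vendored fact (`gkp_besov_blowup_of_gkp`, `gkp_besov_blowup_of_albritton_facts`).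

## References

* I. Gallagher, G. S. Koch, F. Planchon, *Blow-up of critical Besov norms at a potential
  Navier–Stokes singularity*, Comm. Math. Phys. 343 (2016) 39–82 = arXiv:1407.4156: Thm. 1 (p. 5),
  (1.2), (1.3) (p. 4), Rem. 1.3. [cite: GKP2016, Thm. 1]
* M. Fujii, *Sharp non-uniqueness for the Navier–Stokes equations in scaling critical spaces*,
  arXiv:2602.19846 (2026), Thm. 1.2. [cite: Fujii2026, Thm. 1.2]
* H. Miura, *Remark on uniqueness of mild solutions to the Navier–Stokes equations*, J. Funct.
  Anal. 218 (2005) 110–129, Thm. 2.3. [cite: Miura2005, Thm. 2.3]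
-/

noncomputable section

open MeasureTheory TemperedDistribution Set Function Filter Topology
open scoped SchwartzMap ENNReal NNReal

namespace Literature.Analysis.FluidPDE

/-- **`gkp_besov_blowup` = Theorem 1 over GKP's class `𝓛^{1:∞}_{p,q}[T' < T]` + the identification
of the tree's class with `NS(u₀)`.** Hypothesis `hP` is GKP 2016, Thm. 1 transported to
Gallagher–Koch–Planchon's own solution class: with "GKP solution on `[0, T)`" := Besov mild solution
of the class `(s_p, p, q)` lying in `𝓛^{1:∞}_{p,q}[T' < T]` (`MemGKPPathSpace`, the restriction of
`NS(u 0)` to `[0, T)`, `T ≤ T*`, by the uniqueness of (1.2) in the path space) and "`T = T*`" := no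
GKP solution on a longer interval extends it, *every GKP solution with finite `T = T*` has
`limsup_{t → T⁻} ‖U t‖_{Ḃ^{s_p}_{p,q}} = ∞`*, for all `3 < p, q < ∞` and (as everywhere in this file
family) every viscosity `ν > 0` and function-valued solutions. Hypothesis `hId` is the standing
identification of `CriticalRegularity.lean` in the form of `gkp_regularity_persistence_of_pathSpace`
— every `IsBesovMildSolutionOn` solution lies in GKP's path space — which is **not** a published
result and is not asserted here. Together: a maximal solution of the tree lies in the path space by
`hId` and has no extension in GKP's (smaller) class
(`IsMaximalBesovMildSolution.not_exists_extension_pathSpace`), so `hP` applies.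
[cite: GKP2016, Thm. 1] -/
theorem gkp_besov_blowup_of_pathSpaceBlowup
    (hP : ∀ ⦃ν : ℝ⦄, 0 < ν → ∀ ⦃p q : ℝ≥0∞⦄ [Fact (1 ≤ p)], 3 < p → p < ∞ → 3 < q → q < ∞ →
      ∀ ⦃T : ℝ⦄, 0 < T → ∀ ⦃u : ℝ → EuclideanSpace ℝ (Fin 3) → EuclideanSpace ℝ (Fin 3)⦄
        ⦃U : ℝ → 𝓢'(EuclideanSpace ℝ (Fin 3), EuclideanSpace ℂ (Fin 3))⦄,
        IsBesovMildSolutionOn (-1 + 3 / p.toReal) p q T ν u U → MemGKPPathSpace p q T U →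
        (¬ ∃ T' > T, ∃ (v : ℝ → EuclideanSpace ℝ (Fin 3) → EuclideanSpace ℝ (Fin 3))
            (V : ℝ → 𝓢'(EuclideanSpace ℝ (Fin 3), EuclideanSpace ℂ (Fin 3))),
            (IsBesovMildSolutionOn (-1 + 3 / p.toReal) p q T' ν v V ∧ MemGKPPathSpace p q T' V) ∧
              ∀ t ∈ Ico 0 T, v t =ᵐ[volume] u t) →
        limsup (fun t => FunctionSpaces.eHomBesovNorm (-1 + 3 / p.toReal) p q (U t)) (𝓝[<] T) = ∞)
    (hId : ∀ ⦃ν : ℝ⦄, 0 < ν → ∀ ⦃p q : ℝ≥0∞⦄ [Fact (1 ≤ p)], 3 < p → p < ∞ → 3 < q → q < ∞ →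
      ∀ ⦃T : ℝ⦄, 0 < T → ∀ ⦃u : ℝ → EuclideanSpace ℝ (Fin 3) → EuclideanSpace ℝ (Fin 3)⦄
        ⦃U : ℝ → 𝓢'(EuclideanSpace ℝ (Fin 3), EuclideanSpace ℂ (Fin 3))⦄,
        IsBesovMildSolutionOn (-1 + 3 / p.toReal) p q T ν u U → MemGKPPathSpace p q T U) :
    gkp_besov_blowup := by
  intro ν hν p q _ hp₃ hp hq₃ hq T hT u U hmax
  exact hP hν hp₃ hp hq₃ hq hT hmax.isBesovMildSolutionOn
    (hId hν hp₃ hp hq₃ hq hT hmax.isBesovMildSolutionOn) hmax.not_exists_extension_pathSpace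

/-- **Conversely, under the identification the vendored fact contains Theorem 1 over GKP's
class**: granted `hId`, a GKP solution on `[0, T)` with no extension in GKP's class is maximal in the
tree's sense (`isMaximalBesovMildSolution_of_not_exists_extension_pathSpace`: an extension in the
tree's class would lie in the path space), so `gkp_besov_blowup` applies to it (GKP 2016, Thm. 1,
with (1.3)). [cite: GKP2016, Thm. 1] -/
theorem pathSpaceBlowup_of_gkp_besov_blowup (h : gkp_besov_blowup)
    (hId : ∀ ⦃ν : ℝ⦄, 0 < ν → ∀ ⦃p q : ℝ≥0∞⦄ [Fact (1 ≤ p)], 3 < p → p < ∞ → 3 < q → q < ∞ →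
      ∀ ⦃T : ℝ⦄, 0 < T → ∀ ⦃u : ℝ → EuclideanSpace ℝ (Fin 3) → EuclideanSpace ℝ (Fin 3)⦄
        ⦃U : ℝ → 𝓢'(EuclideanSpace ℝ (Fin 3), EuclideanSpace ℂ (Fin 3))⦄,
        IsBesovMildSolutionOn (-1 + 3 / p.toReal) p q T ν u U → MemGKPPathSpace p q T U) :
    ∀ ⦃ν : ℝ⦄, 0 < ν → ∀ ⦃p q : ℝ≥0∞⦄ [Fact (1 ≤ p)], 3 < p → p < ∞ → 3 < q → q < ∞ →
      ∀ ⦃T : ℝ⦄, 0 < T → ∀ ⦃u : ℝ → EuclideanSpace ℝ (Fin 3) → EuclideanSpace ℝ (Fin 3)⦄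
        ⦃U : ℝ → 𝓢'(EuclideanSpace ℝ (Fin 3), EuclideanSpace ℂ (Fin 3))⦄,
        IsBesovMildSolutionOn (-1 + 3 / p.toReal) p q T ν u U → MemGKPPathSpace p q T U →
        (¬ ∃ T' > T, ∃ (v : ℝ → EuclideanSpace ℝ (Fin 3) → EuclideanSpace ℝ (Fin 3))
            (V : ℝ → 𝓢'(EuclideanSpace ℝ (Fin 3), EuclideanSpace ℂ (Fin 3))),
            (IsBesovMildSolutionOn (-1 + 3 / p.toReal) p q T' ν v V ∧ MemGKPPathSpace p q T' V) ∧
              ∀ t ∈ Ico 0 T, v t =ᵐ[volume] u t) →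
        limsup (fun t => FunctionSpaces.eHomBesovNorm (-1 + 3 / p.toReal) p q (U t)) (𝓝[<] T) = ∞ := by
  intro ν hν p q _ hp₃ hp hq₃ hq T hT u U hu _ hnoext
  have hId' : ∀ ⦃T' : ℝ⦄, 0 < T' → ∀ ⦃v : ℝ → EuclideanSpace ℝ (Fin 3) → EuclideanSpace ℝ (Fin 3)⦄
      ⦃V : ℝ → 𝓢'(EuclideanSpace ℝ (Fin 3), EuclideanSpace ℂ (Fin 3))⦄,
      IsBesovMildSolutionOn (-1 + 3 / p.toReal) p q T' ν v V → MemGKPPathSpace p q T' V :=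
    fun T' hT' v V hv => hId hν hp₃ hp hq₃ hq hT' hv
  exact h hν hp₃ hp hq₃ hq hT
    (isMaximalBesovMildSolution_of_not_exists_extension_pathSpace hId' hT hu hnoext)

/-- **Under the identification, the vendored Theorem 1 and Theorem 1 over GKP's class are
equivalent** (`gkp_besov_blowup_of_pathSpaceBlowup` and `pathSpaceBlowup_of_gkp_besov_blowup`; GKP 2016, Thm. 1
with (1.3): the two renderings of "`T = T*(u₀)`" coincide, `isMaximalBesovMildSolution_iff_pathSpace`).
[cite: GKP2016, Thm. 1] -/
theorem gkp_besov_blowup_iff_pathSpaceBlowup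
    (hId : ∀ ⦃ν : ℝ⦄, 0 < ν → ∀ ⦃p q : ℝ≥0∞⦄ [Fact (1 ≤ p)], 3 < p → p < ∞ → 3 < q → q < ∞ →
      ∀ ⦃T : ℝ⦄, 0 < T → ∀ ⦃u : ℝ → EuclideanSpace ℝ (Fin 3) → EuclideanSpace ℝ (Fin 3)⦄
        ⦃U : ℝ → 𝓢'(EuclideanSpace ℝ (Fin 3), EuclideanSpace ℂ (Fin 3))⦄,
        IsBesovMildSolutionOn (-1 + 3 / p.toReal) p q T ν u U → MemGKPPathSpace p q T U) :
    gkp_besov_blowup ↔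
      ∀ ⦃ν : ℝ⦄, 0 < ν → ∀ ⦃p q : ℝ≥0∞⦄ [Fact (1 ≤ p)], 3 < p → p < ∞ → 3 < q → q < ∞ →
        ∀ ⦃T : ℝ⦄, 0 < T → ∀ ⦃u : ℝ → EuclideanSpace ℝ (Fin 3) → EuclideanSpace ℝ (Fin 3)⦄
        ⦃U : ℝ → 𝓢'(EuclideanSpace ℝ (Fin 3), EuclideanSpace ℂ (Fin 3))⦄,
        IsBesovMildSolutionOn (-1 + 3 / p.toReal) p q T ν u U → MemGKPPathSpace p q T U →
        (¬ ∃ T' > T, ∃ (v : ℝ → EuclideanSpace ℝ (Fin 3) → EuclideanSpace ℝ (Fin 3))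
        (V : ℝ → 𝓢'(EuclideanSpace ℝ (Fin 3), EuclideanSpace ℂ (Fin 3))),
        (IsBesovMildSolutionOn (-1 + 3 / p.toReal) p q T' ν v V ∧ MemGKPPathSpace p q T' V) ∧
        ∀ t ∈ Ico 0 T, v t =ᵐ[volume] u t) →
        limsup (fun t => FunctionSpaces.eHomBesovNorm (-1 + 3 / p.toReal) p q (U t)) (𝓝[<] T) = ∞ :=
  ⟨fun h => pathSpaceBlowup_of_gkp_besov_blowup h hId,
    fun h => gkp_besov_blowup_of_pathSpaceBlowup h hId⟩

/-- **Continuation form of Theorem 1 over GKP's class** (GKP 2016, Thm. 1 and the Question of §1.1: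
"does `sup_{0<t<T*} ‖u‖_X < ∞` imply that `T* = +∞`?"): granted Theorem 1 in the path-space form
`hP`, a Besov mild solution on `[0, T)`, `0 < T`, lying in `𝓛^{1:∞}_{p,q}[T' < T]` whose critical
norm stays bounded on `[0, T)` — `sup_{t ∈ [0,T)} ‖U t‖_{Ḃ^{-1+3/p}_{p,q}} < ∞`, hence
`limsup_{t → T⁻} ‖U t‖ < ∞` (`limsup_nhdsLT_le_biSup_Ico`) — is not maximal in GKP's class: it is
extended, within GKP's class, by a solution on a longer interval. This is the shape in which
continuation criteria consume Theorem 1 (compare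
`gkp_besov_blowup.not_isMaximalBesovMildSolution_of_biSup_lt_top` for the tree's class).
[cite: GKP2016, Thm. 1] -/
theorem exists_extension_pathSpace_of_biSup_lt_top
    (hP : ∀ ⦃ν : ℝ⦄, 0 < ν → ∀ ⦃p q : ℝ≥0∞⦄ [Fact (1 ≤ p)], 3 < p → p < ∞ → 3 < q → q < ∞ →
      ∀ ⦃T : ℝ⦄, 0 < T → ∀ ⦃u : ℝ → EuclideanSpace ℝ (Fin 3) → EuclideanSpace ℝ (Fin 3)⦄
        ⦃U : ℝ → 𝓢'(EuclideanSpace ℝ (Fin 3), EuclideanSpace ℂ (Fin 3))⦄,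
        IsBesovMildSolutionOn (-1 + 3 / p.toReal) p q T ν u U → MemGKPPathSpace p q T U →
        (¬ ∃ T' > T, ∃ (v : ℝ → EuclideanSpace ℝ (Fin 3) → EuclideanSpace ℝ (Fin 3))
            (V : ℝ → 𝓢'(EuclideanSpace ℝ (Fin 3), EuclideanSpace ℂ (Fin 3))),
            (IsBesovMildSolutionOn (-1 + 3 / p.toReal) p q T' ν v V ∧ MemGKPPathSpace p q T' V) ∧
              ∀ t ∈ Ico 0 T, v t =ᵐ[volume] u t) →
        limsup (fun t => FunctionSpaces.eHomBesovNorm (-1 + 3 / p.toReal) p q (U t)) (𝓝[<] T) = ∞)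
    {ν : ℝ} (hν : 0 < ν) {p q : ℝ≥0∞} [Fact (1 ≤ p)] (hp₃ : 3 < p) (hp : p < ∞) (hq₃ : 3 < q)
    (hq : q < ∞) {T : ℝ} (hT : 0 < T) {u : ℝ → EuclideanSpace ℝ (Fin 3) → EuclideanSpace ℝ (Fin 3)}
    {U : ℝ → 𝓢'(EuclideanSpace ℝ (Fin 3), EuclideanSpace ℂ (Fin 3))}
    (hu : IsBesovMildSolutionOn (-1 + 3 / p.toReal) p q T ν u U) (hU : MemGKPPathSpace p q T U)
    (hsup : ⨆ t ∈ Ico 0 T, FunctionSpaces.eHomBesovNorm (-1 + 3 / p.toReal) p q (U t) < ∞) :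
    ∃ T' > T, ∃ (v : ℝ → EuclideanSpace ℝ (Fin 3) → EuclideanSpace ℝ (Fin 3))
      (V : ℝ → 𝓢'(EuclideanSpace ℝ (Fin 3), EuclideanSpace ℂ (Fin 3))),
      (IsBesovMildSolutionOn (-1 + 3 / p.toReal) p q T' ν v V ∧ MemGKPPathSpace p q T' V) ∧
        ∀ t ∈ Ico 0 T, v t =ᵐ[volume] u t := by
  by_contra hnoext
  exact ((limsup_nhdsLT_le_biSup_Ico hT).trans_lt hsup).ne (hP hν hp₃ hp hq₃ hq hT hu hU hnoext)

/-- **The singular alternative in GKP's class** (contrapositive of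
`exists_extension_pathSpace_of_biSup_lt_top`; GKP 2016, abstract: "the norm of the solution in that
Besov space becomes unbounded at time `T`"): granted `hP`, a GKP solution on `[0, T)` with no
extension in GKP's class has `sup_{t ∈ [0,T)} ‖U t‖_{Ḃ^{-1+3/p}_{p,q}} = ∞`. [cite: GKP2016, Thm. 1] -/
theorem biSup_eq_top_of_not_exists_extension_pathSpace
    (hP : ∀ ⦃ν : ℝ⦄, 0 < ν → ∀ ⦃p q : ℝ≥0∞⦄ [Fact (1 ≤ p)], 3 < p → p < ∞ → 3 < q → q < ∞ →
      ∀ ⦃T : ℝ⦄, 0 < T → ∀ ⦃u : ℝ → EuclideanSpace ℝ (Fin 3) → EuclideanSpace ℝ (Fin 3)⦄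
        ⦃U : ℝ → 𝓢'(EuclideanSpace ℝ (Fin 3), EuclideanSpace ℂ (Fin 3))⦄,
        IsBesovMildSolutionOn (-1 + 3 / p.toReal) p q T ν u U → MemGKPPathSpace p q T U →
        (¬ ∃ T' > T, ∃ (v : ℝ → EuclideanSpace ℝ (Fin 3) → EuclideanSpace ℝ (Fin 3))
            (V : ℝ → 𝓢'(EuclideanSpace ℝ (Fin 3), EuclideanSpace ℂ (Fin 3))),
            (IsBesovMildSolutionOn (-1 + 3 / p.toReal) p q T' ν v V ∧ MemGKPPathSpace p q T' V) ∧
              ∀ t ∈ Ico 0 T, v t =ᵐ[volume] u t) →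
        limsup (fun t => FunctionSpaces.eHomBesovNorm (-1 + 3 / p.toReal) p q (U t)) (𝓝[<] T) = ∞)
    {ν : ℝ} (hν : 0 < ν) {p q : ℝ≥0∞} [Fact (1 ≤ p)] (hp₃ : 3 < p) (hp : p < ∞) (hq₃ : 3 < q)
    (hq : q < ∞) {T : ℝ} (hT : 0 < T) {u : ℝ → EuclideanSpace ℝ (Fin 3) → EuclideanSpace ℝ (Fin 3)}
    {U : ℝ → 𝓢'(EuclideanSpace ℝ (Fin 3), EuclideanSpace ℂ (Fin 3))}
    (hu : IsBesovMildSolutionOn (-1 + 3 / p.toReal) p q T ν u U) (hU : MemGKPPathSpace p q T U)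
    (hnoext : ¬ ∃ T' > T, ∃ (v : ℝ → EuclideanSpace ℝ (Fin 3) → EuclideanSpace ℝ (Fin 3))
        (V : ℝ → 𝓢'(EuclideanSpace ℝ (Fin 3), EuclideanSpace ℂ (Fin 3))),
      (IsBesovMildSolutionOn (-1 + 3 / p.toReal) p q T' ν v V ∧ MemGKPPathSpace p q T' V) ∧
        ∀ t ∈ Ico 0 T, v t =ᵐ[volume] u t) :
    ⨆ t ∈ Ico 0 T, FunctionSpaces.eHomBesovNorm (-1 + 3 / p.toReal) p q (U t) = ∞ :=
  eq_top_iff.2 <|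
    (hP hν hp₃ hp hq₃ hq hT hu hU hnoext).symm.le.trans (limsup_nhdsLT_le_biSup_Ico hT)

end Literature.Analysis.FluidPDE
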